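import Literature.NumberTheory.EllipticCurves.WZhang2014.SelmerCorankOnePConverse
import Literature.NumberTheory.EllipticCurves.BSDRankZeroDensityProofs
import Literature.NumberTheory.EllipticCurves.BSDSelmerCMPConverseRankOneProofs
import Literature.NumberTheory.EllipticCurves.QuadraticTwistSelmerPInfty
import Literature.NumberTheory.EllipticCurves.ExceptionalPrimesDensityModels
import Literature.NumberTheory.EllipticCurves.NonEisensteinPrimeOfSurjective
import Literature.NumberTheory.EllipticCurves.LeadingTermBSZOrdinaryProofs
import Literature.NumberTheory.EllipticCurves.BSDInvariantsProofs
import HarnessLib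

/-!
# Bhargava–Skinner–Zhang, Theorem 9 (the rank-`1` criterion `#Sel^(p)(E/ℚ) = p ⟹ rank E(ℚ) = 1 ∧
# ord_{s=1} L(E,s) = 1`), GOOD-ORDINARY LEG, in the kernel below W. Zhang 2014 Thm 1.4 (i) and
# Cassels–Tate — and the binder `h9` of `bsz_rankLeOne_cRank_of_pieces` on the good half of `T`

Fifth sibling *proofs* file (theorems only: no definition, no named fact, no instance; D-0014 /
D-0026) of `Literature.NumberTheory.EllipticCurves.LeadingTerm` for the rank part of BSD by naive
height (companion of `LeadingTermBSZRankZeroLegProofs`, the rank-`0` criterion). Source: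

> M. Bhargava, C. Skinner, W. Zhang, *A majority of elliptic curves over `ℚ` satisfy the Birch and
> Swinnerton-Dyer conjecture*, arXiv:1407.1826v2 (2014), **Theorem 9** (§2.2, p. 5): "Let `p ≥ 5`
> be a prime. Let `E` be an elliptic curve over `ℚ` with conductor `N` such that: (a) `E` has good
> ordinary or multiplicative reduction at `p`; (b) `E[p]` is an irreducible `Gal(ℚ̄/ℚ)`-module;
> (c) for all primes `ℓ ‖ N` such that `ℓ ≡ ±1 (mod p)`, `E[p]` is ramified at `ℓ`; (d) if `N` is
> not squarefree, then there exist at least two prime factors `ℓ ‖ N` with `ℓ ≠ p` and where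
> `E[p]` is ramified; (e) [conditions at a multiplicative `p`]; (f) the `p`-Selmer group `S_p(E)`
> of `E` has order `p`. Then the rank and analytic rank of `E` are both equal to `1`." Proof
> (ibid.): "By a theorem of Cassels, the `p^∞`-Selmer group of `E` is isomorphic as a
> `ℤ_p`-module to `(ℚ_p/ℤ_p)^r ⊕ F ⊕ F` … Since `E(ℚ)[p]` is trivial under (b), the `p`-Selmer
> group `S_p(E)` is the `p`-torsion of the `p^∞`-Selmer group. Hence if `S_p(E)` has order `p`,
> then `F = 0` and `r = 1`. It follows from this observation and [Z] (for the case of good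
> reduction) and [SZ] (for the case of multiplicative reduction) that … `ord_{s=1} L(E,s) = 1` and
> the rank of `E(ℚ)` is `1`."

The theorem of record `bsz_rankLeOne_cRank_of_pieces` (`LeadingTermBSZResCellAssemblyProofs`)
consumes Theorem 9 at `p = 5` as the ANONYMOUS binder
`h9 : ∀ AB, IsInHeightFamily AB → T AB → S₁ AB → W AB → Nat.card ((shortWeierstrass AB).selmerGroup 5) = 5
→ (shortWeierstrass AB).mordellWeilRank = 1 ∧ (shortWeierstrass AB).analyticRank = 1`. This file
PROVES its GOOD-ORDINARY LEG ("[Z] (for the case of good reduction)") below exactly two named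
published inputs, both in the tree:

* `hZ : WZhang2014.thm14i_rank_one_of_selmerCorank_eq_one` — W. Zhang, Camb. J. Math. 2 (2014),
  Thm. 1.4 (i) AS PRINTED (`WZhang2014/SelmerCorankOnePConverse.lean`; hypotheses (1) `ρ̄_{E,p}`
  surjective — which implies (b) —, (2) = (c), (3) = (d), (4) good ordinary, `p ≥ 5`);
* `hCT : exists_casselsTate_pairing (K := ℚ)` — "a theorem of Cassels" (the alternating pairing on
  `Ш`, Milne *ADT* I.6.13(a)), used exactly as printed: `#Sel^(p) = p ∧ E(ℚ)[p] = 0 ⟹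
  corank_{ℤ_p} Sel_{p^∞}(E/ℚ) = 1` (tree `exists_selmerRank_eq_add`: `s_p = t_p + corank + 2m`).

Contents:
* (PRIVATE) `selmerCorank_eq_one_of_natCard_selmerGroup_eq_prime(_of_irreducible)` — the Cassels
  step, below `hCT` only, kept `private` on the cell lead's word: its PUBLIC Literature-side form is
  `selmerCorank_eq_one_of_natCard_selmerGroup_eq` of `SelmerCardinalityPConverses.lean` (p369066,
  same statement with `#E(K)[p] = 1` as a hypothesis), its Summits-side form x10's
  `Summit.BirchSwinnertonDyer.Rank1Residual.X10.RankOneOfPSelmerOrderP.selmerCorank_eq_one_of_natCard_selmerGroup_eq`;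
  this file imports neither (the former's olean is not built at the time of writing; the latter is
  not importable from `Literature/`);
* `bsz_thm9_goodOrdinary_of_zhang` — **Theorem 9, good-ordinary leg** in Zhang's currency: `W/ℚ`
  globally minimal, `p ≥ 5` good ordinary, (1)–(3) of Zhang, `#Sel^(p)(E/ℚ) = p` ⟹
  `rank E(ℚ) = 1 ∧ ord_{s=1} L(E,s) = 1` (`E(ℚ)[p] = 0` from (1): surjective ⟹ irreducible ⟹ no
  rational `p`-torsion, tree `hasIrreducibleModPGaloisRep_of_hasSurjectiveModNGaloisRep`,
  `natCard_torsionBy_eq_one_of_hasIrreducibleModPGaloisRep`);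
* `bsz_thm9_goodOrdinary_of_zhang_of_smul_eq` — the same for ANY model `E/ℚ` with global minimal
  model `W`, `C • W = E` ((1) and (f) read on `E`; (2)–(4) on `W`, as they mention `a_p`, `Δ_min`;
  transport: tree `hasSurjectiveModNGaloisRep_smul_iff`, `selmerCorank_eq_of_variableChange`,
  `mordellWeilRank_variableChange_holds`, `analyticRank_smul`);
* `bsz_h9_goodOrdinary_five_of_zhang_of_smul_eq` — **the binder `h9` in the `(A, B)` currency on
  the good-ordinary part of `T ⊆ S₀(5)`**: `(A, B)` in the height family, `5 ∤ A`, `5 ∤ 4A³ + 27B²`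
  (good ordinary at `5`: Lemma 17, tree `not_five_dvd_frobeniusTrace_of_not_dvd`), `ρ̄_{E,5}`
  surjective on `E_{A,B}`, Zhang's (2)–(3) on a global minimal model `W` of `E_{A,B}`,
  `#Sel^(5)(E_{A,B}/ℚ) = 5` ⟹ rank `1` ∧ analytic rank `1`.

What is NOT done here: the MULTIPLICATIVE-at-`p` leg ("[SZ]" = Skinner–Zhang arXiv:1407.1099, a
PREPRINT — the sprint's fork (q3)); the sets `T`, `S₁`, `W` themselves (item C0, `BSZPieces.lean`).
BSD-DENSITY SPRINT (cell `b2b-bsdres`, book `cells/density/CONVERSION-QUEUE.md` §2 Q2 / §3 item 3):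
by-name consumer = the D2 glue `bsz_rankLeOne_cRank_of_facts` (seat `b2b-bsdres-dens-p1`). HONEST
FRAMING: kernel glue below NAMED published inputs; nothing is booked; no density number,
RESIDUAL-MAP mark, tier or status word moves by this file.

## References

* [BhargavaSkinnerZhang2014] M. Bhargava, C. Skinner, W. Zhang, arXiv:1407.1826v2, Thm. 9 and its
  proof (§2.2, p. 5); Lemma 17 (p. 8).
* [WZhang2014] W. Zhang, *Selmer groups and the indivisibility of Heegner points*, Camb. J. Math.
  2 (2014), 191–253, Thm. 1.4 (i) (p. 197).
* [SilvermanAEC2009] J. H. Silverman, *The Arithmetic of Elliptic Curves*, 2nd ed., GTM 106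
  (2009), Thm. X.4.2, Thm. X.4.14 (Cassels–Tate), X.§4, VIII.8 Cor. 8.3.
* [MilneADT2006] J. S. Milne, *Arithmetic Duality Theorems*, 2nd ed. (2006), I.6.13(a).
-/

noncomputable section

open scoped Classical
open scoped AddSubgroup

open WeierstrassCurve Literature.NumberTheory.EllipticCurves.BSZLemma17

namespace Literature.NumberTheory.EllipticCurves

/-! ### The Cassels step: `#Sel^(p) = p`, `E(ℚ)[p] = 0` ⟹ corank `1` -/

section Cassels

/-- **"Hence if `S_p(E)` has order `p`, then `F = 0` and `r = 1`"** (BSZ, proof of Thm 9): for an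
elliptic `W/ℚ` and a prime `p`, if `#Sel^(p)(E/ℚ) = p` and `E(ℚ)[p] = 0` then
`corank_{ℤ_p} Sel_{p^∞}(E/ℚ) = 1` — below the Cassels–Tate pairing only (`hCT`): the tree's
`exists_selmerRank_eq_add` gives `s_p = t_p + corank + 2m` for `#Sel^(p) = p^{s_p}`,
`#E(ℚ)[p] = p^{t_p}`, here `s_p = 1`, `t_p = 0`. [cite: BhargavaSkinnerZhang2014, Thm. 9 (proof, §2.2, p. 5)]
[cite: SilvermanAEC2009, Thm. X.4.14] -/
private theorem selmerCorank_eq_one_of_natCard_selmerGroup_eq_prime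
    (hCT : exists_casselsTate_pairing (K := ℚ))
    (W : WeierstrassCurve ℚ) [W.IsElliptic] (p : ℕ) [Fact p.Prime]
    (hs : Nat.card (W.selmerGroup p) = p) (ht : W.toAffine.Point[(p : ℤ)] = ⊥) :
    W.selmerCorank p = 1 := by
  have ht' : Nat.card (W.toAffine.Point[(p : ℤ)]) = p ^ 0 := by
    rw [pow_zero, ht, AddSubgroup.card_bot]
  obtain ⟨m, hm⟩ := exists_selmerRank_eq_add hCT W p 1 0 (by rw [pow_one]; exact hs)
    (by convert ht')
  omega

/-- The same with the torsion hypothesis discharged by (b)/(1): if `E[p]` is IRREDUCIBLE then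
`E(ℚ)[p] = 0` (tree `natCard_torsionBy_eq_one_of_hasIrreducibleModPGaloisRep`), so
`#Sel^(p)(E/ℚ) = p ⟹ corank_{ℤ_p} Sel_{p^∞}(E/ℚ) = 1` below `hCT` ("Since `E(ℚ)[p]` is trivial
under (b) …", BSZ loc. cit.). [cite: BhargavaSkinnerZhang2014, Thm. 9 (proof, §2.2, p. 5)] -/
private theorem selmerCorank_eq_one_of_natCard_selmerGroup_eq_prime_of_irreducible
    (hCT : exists_casselsTate_pairing (K := ℚ))
    (W : WeierstrassCurve ℚ) [W.IsElliptic] (p : ℕ) [Fact p.Prime]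
    (hirr : W.HasIrreducibleModPGaloisRep p) (hs : Nat.card (W.selmerGroup p) = p) :
    W.selmerCorank p = 1 :=
  selmerCorank_eq_one_of_natCard_selmerGroup_eq_prime hCT W p hs
    (AddSubgroup.eq_bot_of_card_eq _
      (natCard_torsionBy_eq_one_of_hasIrreducibleModPGaloisRep W p hirr))

end Cassels

/-! ### Theorem 9, good-ordinary leg, below W. Zhang 2014 Thm 1.4 (i) -/

section GoodOrdinary

/-- **Bhargava–Skinner–Zhang Thm 9, GOOD-ORDINARY LEG, in W. Zhang's currency.** Let `E/ℚ` have
globally minimal model `W` and let `p ≥ 5` be a prime of good ordinary reduction (`hgood`,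
`hord : p ∤ a_p`) such that (1) `ρ̄_{E,p}` is surjective (`hsurj`), (2) every multiplicative
prime `ℓ ≡ ±1 (mod p)` has `p ∤ v_ℓ(Δ_min)` (`h2`; printed (c)), (3) if `W` is not semistable
then `Ram(ρ̄_{E,p}) ≠ ∅` and, when `#Ram = 1`, the number of multiplicative primes is even (`h3`;
printed (d)), and `#Sel^(p)(E/ℚ) = p` (printed (f)). Then `rank E(ℚ) = 1 ∧ ord_{s=1} L(E,s) = 1`
— granted W. Zhang 2014 Thm. 1.4 (i) (`hZ`) and the Cassels–Tate pairing (`hCT`): surjective ⟹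
irreducible (`hasIrreducibleModPGaloisRep_of_hasSurjectiveModNGaloisRep`) ⟹ `E(ℚ)[p] = 0`, so
corank `1` (`selmerCorank_eq_one_of_natCard_selmerGroup_eq_prime_of_irreducible`), and Zhang's
theorem gives both conclusions. [cite: BhargavaSkinnerZhang2014, Thm. 9 and its proof (§2.2, p. 5)]
[cite: WZhang2014, Thm. 1.4 (i) (p. 197)] -/
theorem bsz_thm9_goodOrdinary_of_zhang
    (hZ : WZhang2014.thm14i_rank_one_of_selmerCorank_eq_one)
    (hCT : exists_casselsTate_pairing (K := ℚ))
    (W : WeierstrassCurve ℚ) [W.IsElliptic] [W.IsGloballyMinimal] (p : ℕ) [Fact p.Prime]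
    (hp : 5 ≤ p) (hgood : W.HasGoodReductionAtPrime p) (hord : ¬ (p : ℤ) ∣ W.frobeniusTrace p)
    (hsurj : W.HasSurjectiveModNGaloisRep p)
    (h2 : ∀ (ℓ : ℕ) [Fact ℓ.Prime], W.HasMultiplicativeReductionAtPrime ℓ →
      (p ∣ ℓ - 1 ∨ p ∣ ℓ + 1) → ¬ p ∣ padicValInt ℓ W.minimalDiscriminantInt)
    (h3 : ¬ W.IsSemistable ℤ →
      (∃ ℓ : ℕ, ∃ _ : Fact ℓ.Prime, W.HasMultiplicativeReductionAtPrime ℓ ∧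
          ¬ p ∣ padicValInt ℓ W.minimalDiscriminantInt) ∧
        (Set.ncard {ℓ : ℕ | ∃ _ : Fact ℓ.Prime, W.HasMultiplicativeReductionAtPrime ℓ ∧
            ¬ p ∣ padicValInt ℓ W.minimalDiscriminantInt} = 1 →
          Even (Set.ncard {ℓ : ℕ | ∃ _ : Fact ℓ.Prime, W.HasMultiplicativeReductionAtPrime ℓ})))
    (hSel : Nat.card (W.selmerGroup p) = p) :
    W.mordellWeilRank = 1 ∧ W.analyticRank = 1 := by
  haveI : NeZero ((p : ℕ) : ℚ) := ⟨Nat.cast_ne_zero.mpr (Fact.out : p.Prime).ne_zero⟩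
  have hirr : W.HasIrreducibleModPGaloisRep p :=
    hasIrreducibleModPGaloisRep_of_hasSurjectiveModNGaloisRep W p hsurj
  have h1 : W.selmerCorank p = 1 :=
    selmerCorank_eq_one_of_natCard_selmerGroup_eq_prime_of_irreducible hCT W p hirr hSel
  exact WZhang2014.rank_eq_one_and_analyticRank_eq_one_of_thm14i hZ W p hp hgood hord hsurj h2 h3 h1

/-- **Thm 9, good-ordinary leg, for an ARBITRARY model.** `E/ℚ` elliptic with global minimal
model `W`, `C • W = E`; `p ≥ 5`; (4), (2), (3) read on `W`; (1) `ρ̄_{E,p}` surjective and (f)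
`#Sel^(p)(E/ℚ) = p` read on `E` (isomorphism invariants: tree `hasSurjectiveModNGaloisRep_smul_iff`,
`selmerCorank_eq_of_variableChange`). Conclusion for `E`, transported back along
`mordellWeilRank_variableChange_holds` and `analyticRank_smul`.
[cite: BhargavaSkinnerZhang2014, Thm. 9 (§2.2, p. 5)] [cite: SilvermanAEC2009, X.§4 and VIII.8 Cor. 8.3] -/
theorem bsz_thm9_goodOrdinary_of_zhang_of_smul_eq
    (hZ : WZhang2014.thm14i_rank_one_of_selmerCorank_eq_one)
    (hCT : exists_casselsTate_pairing (K := ℚ))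
    {W : WeierstrassCurve ℚ} [W.IsElliptic] [W.IsGloballyMinimal] {C : VariableChange ℚ}
    {E : WeierstrassCurve ℚ} [E.IsElliptic] (hCW : C • W = E) (p : ℕ) [Fact p.Prime]
    (hp : 5 ≤ p) (hgood : W.HasGoodReductionAtPrime p) (hord : ¬ (p : ℤ) ∣ W.frobeniusTrace p)
    (hsurj : E.HasSurjectiveModNGaloisRep p)
    (h2 : ∀ (ℓ : ℕ) [Fact ℓ.Prime], W.HasMultiplicativeReductionAtPrime ℓ →
      (p ∣ ℓ - 1 ∨ p ∣ ℓ + 1) → ¬ p ∣ padicValInt ℓ W.minimalDiscriminantInt)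
    (h3 : ¬ W.IsSemistable ℤ →
      (∃ ℓ : ℕ, ∃ _ : Fact ℓ.Prime, W.HasMultiplicativeReductionAtPrime ℓ ∧
          ¬ p ∣ padicValInt ℓ W.minimalDiscriminantInt) ∧
        (Set.ncard {ℓ : ℕ | ∃ _ : Fact ℓ.Prime, W.HasMultiplicativeReductionAtPrime ℓ ∧
            ¬ p ∣ padicValInt ℓ W.minimalDiscriminantInt} = 1 →
          Even (Set.ncard {ℓ : ℕ | ∃ _ : Fact ℓ.Prime, W.HasMultiplicativeReductionAtPrime ℓ})))
    (hSel : Nat.card (E.selmerGroup p) = p) :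
    E.mordellWeilRank = 1 ∧ E.analyticRank = 1 := by
  haveI : NeZero ((p : ℕ) : ℚ) := ⟨Nat.cast_ne_zero.mpr (Fact.out : p.Prime).ne_zero⟩
  have hWE : C⁻¹ • E = W := by rw [← hCW, smul_smul, inv_mul_cancel, one_smul]
  -- (1) and the corank on the minimal model
  have hsurjW : W.HasSurjectiveModNGaloisRep p := by
    rw [← hWE]; exact (hasSurjectiveModNGaloisRep_smul_iff E C⁻¹ p).2 hsurj
  have hirrE : E.HasIrreducibleModPGaloisRep p :=
    hasIrreducibleModPGaloisRep_of_hasSurjectiveModNGaloisRep E p hsurj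
  have h1E : E.selmerCorank p = 1 :=
    selmerCorank_eq_one_of_natCard_selmerGroup_eq_prime_of_irreducible hCT E p hirrE hSel
  have h1W : W.selmerCorank p = 1 := by
    rw [← selmerCorank_eq_of_variableChange p hWE]; exact h1E
  obtain ⟨hrkW, hanW⟩ :=
    WZhang2014.rank_eq_one_and_analyticRank_eq_one_of_thm14i hZ W p hp hgood hord hsurjW h2 h3 h1W
  refine ⟨?_, ?_⟩
  · have h : (C⁻¹ • E).mordellWeilRank = E.mordellWeilRank := mordellWeilRank_variableChange_holds E C⁻¹
    rw [← h, hWE, hrkW]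
  · rw [← analyticRank_smul E C⁻¹, hWE, hanW]

/-- **The binder `h9` of `bsz_rankLeOne_cRank_of_pieces` in the `(A, B)` currency, on the
GOOD-ORDINARY part of `T`, below `hZ` and `hCT`.** For `(A, B)` in the height family and a global
minimal model `W` of `E_{A,B}` (`C • W = E_{A,B}`): if `5 ∤ A` and `5 ∤ 4A³ + 27B²` — `E_{A,B}` has
good ORDINARY reduction at `5` (Lemma 17 of the source; tree `not_five_dvd_frobeniusTrace_of_not_dvd`,
`hasGoodReductionAtPrime_shortWeierstrass_iff_of_isInHeightFamily`) —, `ρ̄_{E_{A,B},5}` is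
surjective, Zhang's (2)–(3) hold for `W` at `p = 5`, and `#Sel^(5)(E_{A,B}/ℚ) = 5`, then
`rank E_{A,B}(ℚ) = 1 ∧ ord_{s=1} L(E_{A,B}, s) = 1`. (The multiplicative-at-`5` part of `T` is
[SZ], a preprint — not covered.) [cite: BhargavaSkinnerZhang2014, Thm. 9 (§2.2, p. 5) and Lemma 17 (p. 8)]
[cite: WZhang2014, Thm. 1.4 (i) (p. 197)] -/
theorem bsz_h9_goodOrdinary_five_of_zhang_of_smul_eq
    (hZ : WZhang2014.thm14i_rank_one_of_selmerCorank_eq_one)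
    (hCT : exists_casselsTate_pairing (K := ℚ))
    {W : WeierstrassCurve ℚ} [W.IsElliptic] [W.IsGloballyMinimal] {C : VariableChange ℚ}
    {AB : ℤ × ℤ} (hfam : IsInHeightFamily AB) (hCW : C • W = shortWeierstrass AB)
    (hA : ¬ (5 : ℤ) ∣ AB.1) (hD : ¬ (5 : ℤ) ∣ 4 * AB.1 ^ 3 + 27 * AB.2 ^ 2)
    (hsurj : (shortWeierstrass AB).HasSurjectiveModNGaloisRep 5)
    (h2 : ∀ (ℓ : ℕ) [Fact ℓ.Prime], W.HasMultiplicativeReductionAtPrime ℓ →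
      (5 ∣ ℓ - 1 ∨ 5 ∣ ℓ + 1) → ¬ 5 ∣ padicValInt ℓ W.minimalDiscriminantInt)
    (h3 : ¬ W.IsSemistable ℤ →
      (∃ ℓ : ℕ, ∃ _ : Fact ℓ.Prime, W.HasMultiplicativeReductionAtPrime ℓ ∧
          ¬ 5 ∣ padicValInt ℓ W.minimalDiscriminantInt) ∧
        (Set.ncard {ℓ : ℕ | ∃ _ : Fact ℓ.Prime, W.HasMultiplicativeReductionAtPrime ℓ ∧
            ¬ 5 ∣ padicValInt ℓ W.minimalDiscriminantInt} = 1 →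
          Even (Set.ncard {ℓ : ℕ | ∃ _ : Fact ℓ.Prime, W.HasMultiplicativeReductionAtPrime ℓ})))
    (hSel : Nat.card ((shortWeierstrass AB).selmerGroup 5) = 5) :
    (shortWeierstrass AB).mordellWeilRank = 1 ∧ (shortWeierstrass AB).analyticRank = 1 := by
  haveI := isElliptic_shortWeierstrass hfam
  haveI : Fact (Nat.Prime 5) := ⟨Nat.prime_five⟩
  have hgood : W.HasGoodReductionAtPrime 5 := by
    rw [← hasGoodReductionAtPrime_smul_iff W C 5, hCW]
    exact (hasGoodReductionAtPrime_shortWeierstrass_iff_of_isInHeightFamily 5 hfam le_rfl).2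
      (by exact_mod_cast hD)
  have hord : ¬ (5 : ℤ) ∣ W.frobeniusTrace 5 := not_five_dvd_frobeniusTrace_of_not_dvd hCW hA hD
  exact bsz_thm9_goodOrdinary_of_zhang_of_smul_eq hZ hCT hCW 5 le_rfl hgood (by exact_mod_cast hord)
    (by exact_mod_cast hsurj) (by exact_mod_cast h2) (by exact_mod_cast h3) (by exact_mod_cast hSel)

end GoodOrdinary

end Literature.NumberTheory.EllipticCurves

end
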